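import Mathlib
import Summits.Ventures.PercRepro2.SwOutAll
import Summits.Ventures.PercRepro2.SwOutSeriesDefs
import Summits.Ventures.PercRepro2.SwOutSeriesDelete

/-!
# The series reduction inside an outside class, part 5: the deletion half — tags and the count
(blind cell PercRepro2, night-4 g10, 2026-08-25; proofs/NIGHT4-G10.md §2 (b))

For `ζ e₁ ≠ ζ e₂` the red / blue edges of the clusters of `h` in `G` are those of `G − u` TAGGED by
the open edge at its end (`redEdges_delete_of_open`, `redEdges_delete_of_open'`,
`blueEdges_delete_of_open`, `blueEdges_delete_of_open'`), and the configurations with prescribed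
different colours at `u` are in bijection with the deleted class (`card_filter_diff_eq`); hence the
four counts `card_diff_red₁`, `card_diff_red₂`, `card_diff_blue₁`, `card_diff_blue₂` — note the
swap of the tags between the red and the blue side, which is what regroups the cut part into two
instances of the smaller statement.
-/

namespace Summit.Ventures.PercRepro2

namespace LocRows

open Hull

variable {V : Type*} {E : Type*} [Fintype E] [DecidableEq E]

open scoped Classical

variable {ends : E → Sym2 V} {u p q : V} {e₁ e₂ : E}

section DeleteEdges

variable (hs : IsSeriesAt ends u p q e₁ e₂)
include hs

/-- **The red edge set under deletion** (`e₁` open, `e₂` closed): the red edges of `C_R(h)` in `G`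
are the red edges of `C_R(h)` in `G − u` tagged by `e₁` at `p`. -/
theorem redEdges_delete_of_open {h : V} (huh : u ≠ h) {ζ : Config E} (h₁ : ζ e₁ = true)
    (h₂ : ζ e₂ = false) (b₁ b₂ : Bool) :
    redEdges ends ζ h =
      tagSub (deleteSeries ends u e₁ e₂) h e₁ p
        (redEdges (deleteSeries ends u e₁ e₂) (Function.update (Function.update ζ e₂ b₂) e₁ b₁) h) := by
  have hdiff : ζ e₁ ≠ ζ e₂ := by rw [h₁, h₂]; decide
  set ends' := deleteSeries ends u e₁ e₂ with hends'
  set ζ' := Function.update (Function.update ζ e₂ b₂) e₁ b₁ with hζ'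
  have hC : ∀ v, v ≠ u → (v ∈ cluster ends ζ h ↔ v ∈ cluster ends' ζ' h) :=
    fun v hv => mem_cluster_delete_iff_of_diff hs hdiff b₁ b₂ huh.symm hv
  have hCu : u ∈ cluster ends ζ h ↔ p ∈ cluster ends' ζ' h := by
    rw [mem_cluster_delete_u_iff_of_diff hs hdiff b₁ b₂ huh.symm]
    simp only [h₁, h₂, Bool.false_eq_true, false_and, or_false, true_and]
    exact Iff.rfl
  have hu' : u ∉ cluster ends' ζ' h := u_notMem_cluster_delete hs huh.symm
  have hends'₁ : ends' e₁ = s(u, u) := deleteSeries_apply_e₁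
  have hends'₂ : ends' e₂ = s(u, u) := deleteSeries_apply_e₂ hs.ne
  have hR1 : e₁ ∉ within ends' (cluster ends' ζ' h) := by
    rw [within_iff_of_ends hends'₁]; exact fun h' => hu' h'.1
  have hR2 : e₂ ∉ within ends' (cluster ends' ζ' h) := by
    rw [within_iff_of_ends hends'₂]; exact fun h' => hu' h'.1
  have hclu : cluster ends' ζ' h = insert h {x | ∃ e ∈ redEdges ends' ζ' h, x ∈ ends' e} :=
    cluster_eq_insert_ends_redEdges ζ' h
  ext e
  rw [mem_tagSub_iff, mem_redEdges, mem_redEdges]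
  by_cases he₁ : e = e₁
  · subst e
    rw [within_iff_of_ends hs.ends₁]
    constructor
    · rintro ⟨_, hu, _⟩
      exact Or.inr ⟨rfl, by rw [← hclu]; exact hCu.1 hu⟩
    · rintro (⟨_, hw⟩ | ⟨_, hp⟩)
      · exact absurd hw hR1
      · rw [← hclu] at hp
        exact ⟨h₁, hCu.2 hp, (hC p hs.up.symm).2 hp⟩
  by_cases he₂ : e = e₂
  · subst e
    constructor
    · rintro ⟨h', _⟩
      rw [h₂] at h'
      exact absurd h' (by decide)
    · rintro (⟨_, hw⟩ | ⟨h', _⟩)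
      · exact absurd hw hR2
      · exact absurd h' hs.ne.symm
  · have hζ'e : ζ' e = ζ e := by
      rw [hζ', Function.update_of_ne he₁, Function.update_of_ne he₂]
    have hends'e : ends' e = ends e := deleteSeries_apply_of_ne he₁ he₂
    rw [hζ'e]
    simp only [he₁, false_and, or_false]
    constructor
    · rintro ⟨he, x, hx, y, hy, hxy⟩
      have hxu : x ≠ u := ne_u_of_mem_ends hs he₁ he₂ (by rw [hxy]; exact Sym2.mem_mk_left x y)
      have hyu : y ≠ u := ne_u_of_mem_ends hs he₁ he₂ (by rw [hxy]; exact Sym2.mem_mk_right x y)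
      exact ⟨he, x, (hC x hxu).1 hx, y, (hC y hyu).1 hy, by rw [hends'e]; exact hxy⟩
    · rintro ⟨he, x, hx, y, hy, hxy⟩
      rw [hends'e] at hxy
      have hxu : x ≠ u := ne_u_of_mem_ends hs he₁ he₂ (by rw [hxy]; exact Sym2.mem_mk_left x y)
      have hyu : y ≠ u := ne_u_of_mem_ends hs he₁ he₂ (by rw [hxy]; exact Sym2.mem_mk_right x y)
      exact ⟨he, x, (hC x hxu).2 hx, y, (hC y hyu).2 hy, hxy⟩

/-- **The red edge set under deletion** (`e₂` open, `e₁` closed): tagged by `e₂` at `q`. -/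
theorem redEdges_delete_of_open' {h : V} (huh : u ≠ h) {ζ : Config E} (h₁ : ζ e₁ = false)
    (h₂ : ζ e₂ = true) (b₁ b₂ : Bool) :
    redEdges ends ζ h =
      tagSub (deleteSeries ends u e₁ e₂) h e₂ q
        (redEdges (deleteSeries ends u e₁ e₂) (Function.update (Function.update ζ e₂ b₂) e₁ b₁) h) := by
  rw [deleteSeries_comm hs.ne, Function.update_comm hs.ne.symm]
  exact redEdges_delete_of_open hs.symm huh h₂ h₁ b₂ b₁

/-- **The blue edge set under deletion** (`e₁` red, `e₂` blue): tagged by `e₂` at `q`. -/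
theorem blueEdges_delete_of_open {h : V} (huh : u ≠ h) {ζ : Config E} (h₁ : ζ e₁ = true)
    (h₂ : ζ e₂ = false) :
    blueEdges ends ζ h =
      tagSub (deleteSeries ends u e₁ e₂) h e₂ q
        (blueEdges (deleteSeries ends u e₁ e₂)
          (Function.update (Function.update ζ e₂ false) e₁ false) h) := by
  unfold blueEdges
  rw [blue_update, blue_update]
  have h₁' : blue ζ e₁ = false := by simp [blue, h₁]
  have h₂' : blue ζ e₂ = true := by simp [blue, h₂]
  exact redEdges_delete_of_open' hs huh h₁' h₂' true true

/-- **The blue edge set under deletion** (`e₁` blue, `e₂` red): tagged by `e₁` at `p`. -/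
theorem blueEdges_delete_of_open' {h : V} (huh : u ≠ h) {ζ : Config E} (h₁ : ζ e₁ = false)
    (h₂ : ζ e₂ = true) :
    blueEdges ends ζ h =
      tagSub (deleteSeries ends u e₁ e₂) h e₁ p
        (blueEdges (deleteSeries ends u e₁ e₂)
          (Function.update (Function.update ζ e₂ false) e₁ false) h) := by
  unfold blueEdges
  rw [blue_update, blue_update]
  have h₁' : blue ζ e₁ = true := by simp [blue, h₁]
  have h₂' : blue ζ e₂ = false := by simp [blue, h₂]
  exact redEdges_delete_of_open hs huh h₁' h₂' true true

end DeleteEdges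

section DeleteCount

variable (hs : IsSeriesAt ends u p q e₁ e₂)
include hs

/-- **The configurations with prescribed different colours at `u` are in bijection with the deleted
class**, for any pair of predicates that correspond under the canonical map
`ζ ↦ ζ[e₁, e₂ ↦ false]`. -/
theorem card_filter_diff_eq {U : Set V} {ξ : Config E} {l h o : V} (hu : u ∈ U) (huh : u ≠ h)
    (hul : u ≠ l) (huo : u ≠ o) (c₁ c₂ : Bool) (hc : c₁ ≠ c₂) (P : Config E → Prop)
    (P' : Config E → Prop)
    (hPP : ∀ ζ, ζ e₁ = c₁ → ζ e₂ = c₂ →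
      (P ζ ↔ P' (Function.update (Function.update ζ e₂ false) e₁ false))) :
    ((swOutSide ends l h o U ξ).filter fun ζ => ζ e₁ = c₁ ∧ ζ e₂ = c₂ ∧ P ζ).card =
      ((swOutSide (deleteSeries ends u e₁ e₂) l h o (U \ {u})
        (Function.update (Function.update ξ e₂ false) e₁ false)).filter fun ζ' => P' ζ').card := by
  refine Finset.card_bij (fun ζ _ => Function.update (Function.update ζ e₂ false) e₁ false) ?_ ?_ ?_
  · intro ζ hζ
    rw [Finset.mem_filter] at hζ ⊢
    obtain ⟨hζ, h₁, h₂, hP⟩ := hζ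
    have hdiff : ζ e₁ ≠ ζ e₂ := by rw [h₁, h₂]; exact hc
    exact ⟨(mem_swOutSide_delete_iff_of_diff hs hu huh hul huo hdiff).1 hζ, (hPP ζ h₁ h₂).1 hP⟩
  · intro ζ₁ hζ₁ ζ₂ hζ₂ heq
    rw [Finset.mem_filter] at hζ₁ hζ₂
    funext e
    by_cases he₁ : e = e₁
    · subst e; rw [hζ₁.2.1, hζ₂.2.1]
    by_cases he₂ : e = e₂
    · subst e; rw [hζ₁.2.2.1, hζ₂.2.2.1]
    · have := congrFun heq e
      rwa [Function.update_of_ne he₁, Function.update_of_ne he₂, Function.update_of_ne he₁,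
        Function.update_of_ne he₂] at this
  · intro ζ' hζ'
    rw [Finset.mem_filter] at hζ'
    -- both loops are pinned `false` in the deleted class
    have hmem := (mem_swOutSide.1 hζ'.1).2
    rw [mem_outClass] at hmem
    have hpin₁ : ζ' e₁ = false := by
      have := hmem.1 e₁ (by rw [mem_touches_delete_iff hs]; exact fun h' => h'.2.1 rfl)
      rw [this]; simp
    have hpin₂ : ζ' e₂ = false := by
      have := hmem.1 e₂ (by rw [mem_touches_delete_iff hs]; exact fun h' => h'.2.2 rfl)
      rw [this]; simp [Function.update_of_ne hs.ne.symm]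
    refine ⟨Function.update (Function.update ζ' e₂ c₂) e₁ c₁, ?_, ?_⟩
    · have h₁ : Function.update (Function.update ζ' e₂ c₂) e₁ c₁ e₁ = c₁ := by simp
      have h₂ : Function.update (Function.update ζ' e₂ c₂) e₁ c₁ e₂ = c₂ := by
        simp [Function.update_of_ne hs.ne.symm]
      have hdiff : Function.update (Function.update ζ' e₂ c₂) e₁ c₁ e₁ ≠
          Function.update (Function.update ζ' e₂ c₂) e₁ c₁ e₂ := by rw [h₁, h₂]; exact hc
      have hback : Function.update (Function.update
          (Function.update (Function.update ζ' e₂ c₂) e₁ c₁) e₂ false) e₁ false = ζ' := by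
        funext e
        by_cases he₁ : e = e₁
        · subst e; simp [hpin₁]
        by_cases he₂ : e = e₂
        · subst e; simp [Function.update_of_ne hs.ne.symm, hpin₂]
        · simp [Function.update_of_ne he₁, Function.update_of_ne he₂]
      rw [Finset.mem_filter]
      refine ⟨?_, h₁, h₂, ?_⟩
      · rw [mem_swOutSide_delete_iff_of_diff hs hu huh hul huo hdiff, hback]
        exact hζ'.1
      · rw [hPP _ h₁ h₂, hback]
        exact hζ'.2
    · funext e
      by_cases he₁ : e = e₁
      · subst e; simp [hpin₁]
      by_cases he₂ : e = e₂
      · subst e; simp [Function.update_of_ne hs.ne.symm, hpin₂]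
      · simp [Function.update_of_ne he₁, Function.update_of_ne he₂]

/-- Red edges, `e₁` red and `e₂` blue: the count of the deleted class for the up-set tagged by `e₁`. -/
theorem card_diff_red₁ {U : Set V} {ξ : Config E} {l h o : V} (hu : u ∈ U) (huh : u ≠ h)
    (hul : u ≠ l) (huo : u ≠ o) (𝓔 : Set (Set E)) :
    ((swOutSide ends l h o U ξ).filter fun ζ =>
        ζ e₁ = true ∧ ζ e₂ = false ∧ redEdges ends ζ h ∈ 𝓔).card =
      ((swOutSide (deleteSeries ends u e₁ e₂) l h o (U \ {u})
        (Function.update (Function.update ξ e₂ false) e₁ false)).filter fun ζ' =>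
          redEdges (deleteSeries ends u e₁ e₂) ζ' h ∈
            tagSub (deleteSeries ends u e₁ e₂) h e₁ p ⁻¹' 𝓔).card := by
  refine card_filter_diff_eq hs hu huh hul huo true false (by decide) _ _ fun ζ h₁ h₂ => ?_
  rw [Set.mem_preimage, redEdges_delete_of_open hs huh h₁ h₂ false false]

/-- Red edges, `e₁` blue and `e₂` red: the up-set tagged by `e₂`. -/
theorem card_diff_red₂ {U : Set V} {ξ : Config E} {l h o : V} (hu : u ∈ U) (huh : u ≠ h)
    (hul : u ≠ l) (huo : u ≠ o) (𝓔 : Set (Set E)) :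
    ((swOutSide ends l h o U ξ).filter fun ζ =>
        ζ e₁ = false ∧ ζ e₂ = true ∧ redEdges ends ζ h ∈ 𝓔).card =
      ((swOutSide (deleteSeries ends u e₁ e₂) l h o (U \ {u})
        (Function.update (Function.update ξ e₂ false) e₁ false)).filter fun ζ' =>
          redEdges (deleteSeries ends u e₁ e₂) ζ' h ∈
            tagSub (deleteSeries ends u e₁ e₂) h e₂ q ⁻¹' 𝓔).card := by
  refine card_filter_diff_eq hs hu huh hul huo false true (by decide) _ _ fun ζ h₁ h₂ => ?_
  rw [Set.mem_preimage, redEdges_delete_of_open' hs huh h₁ h₂ false false]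

/-- Blue edges, `e₁` red and `e₂` blue: the up-set tagged by `e₂`. -/
theorem card_diff_blue₁ {U : Set V} {ξ : Config E} {l h o : V} (hu : u ∈ U) (huh : u ≠ h)
    (hul : u ≠ l) (huo : u ≠ o) (𝓔 : Set (Set E)) :
    ((swOutSide ends l h o U ξ).filter fun ζ =>
        ζ e₁ = true ∧ ζ e₂ = false ∧ blueEdges ends ζ h ∈ 𝓔).card =
      ((swOutSide (deleteSeries ends u e₁ e₂) l h o (U \ {u})
        (Function.update (Function.update ξ e₂ false) e₁ false)).filter fun ζ' =>
          blueEdges (deleteSeries ends u e₁ e₂) ζ' h ∈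
            tagSub (deleteSeries ends u e₁ e₂) h e₂ q ⁻¹' 𝓔).card := by
  refine card_filter_diff_eq hs hu huh hul huo true false (by decide) _ _ fun ζ h₁ h₂ => ?_
  rw [Set.mem_preimage, blueEdges_delete_of_open hs huh h₁ h₂]

/-- Blue edges, `e₁` blue and `e₂` red: the up-set tagged by `e₁`. -/
theorem card_diff_blue₂ {U : Set V} {ξ : Config E} {l h o : V} (hu : u ∈ U) (huh : u ≠ h)
    (hul : u ≠ l) (huo : u ≠ o) (𝓔 : Set (Set E)) :
    ((swOutSide ends l h o U ξ).filter fun ζ =>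
        ζ e₁ = false ∧ ζ e₂ = true ∧ blueEdges ends ζ h ∈ 𝓔).card =
      ((swOutSide (deleteSeries ends u e₁ e₂) l h o (U \ {u})
        (Function.update (Function.update ξ e₂ false) e₁ false)).filter fun ζ' =>
          blueEdges (deleteSeries ends u e₁ e₂) ζ' h ∈
            tagSub (deleteSeries ends u e₁ e₂) h e₁ p ⁻¹' 𝓔).card := by
  refine card_filter_diff_eq hs hu huh hul huo false true (by decide) _ _ fun ζ h₁ h₂ => ?_
  rw [Set.mem_preimage, blueEdges_delete_of_open' hs huh h₁ h₂]

end DeleteCount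

end LocRows

end Summit.Ventures.PercRepro2
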